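import Summits.PneNP.PneNP.Theorems.CliqueExtLowerBound.Negative.LargeCliquesHashing
import Literature.Computability.Complexity.NegationElimination

/-!
# `CliqueExtLowerBound` (stmt-PneNP-10682) — negative-side lemmas: very large cliques IV (plain monotone circuits)

Continuation of `LargeCliquesTwoSat` / `LargeCliquesCircuit` / `LargeCliquesHashing`. The construction of
files II–III uses unbounded fan-in `∧`/`∨` gates (one CONV gate of width one each, enough for the crux's
basis `extGate`). This file re-runs the same programme over the basis `{∧₂, ∨₂, 0, 1}` (n-ary ∧/∨ as
chains: `cktSize_andAll01`, `cktSize_orAll01`; `cktSize_family01`, `cutCircuitSize01 m ≤ 63 m⁴`) and then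
removes the constants (`GateList.const_or_exists_monotone_circuit`; CLIQUE(m, s) is not constant for
`2 ≤ s ≤ m`, `cliqueFn_nonconst`), giving the literature-level statement

* `exists_monotone_circuit_largeClique` — **for every `c ≥ 1`, eventually in `m`, CLIQUE(m, m - c·⌊log₃ m⌋)
  is computed by a monotone `{∧₂, ∨₂}`-circuit with at most `m^(c+7)` gates.**

Andreev–Jukna 2008 (S. Jukna, *Boolean Function Complexity* (2012), Thm 9.7) give polynomial monotone
formulas for `m - k = O(√log m)` and (Prop. 9.6, padding Alon–Boppana) a `2^Ω((m-k)^(1/3))` monotone lower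
bound, superpolynomial only for `m - k = ω(log³ m)`; Chen–Hirahara–Oliveira–Pich–Rajgopal–Santhanam (J. ACM
2022, HM Frontier E) quote `k ≤ √log n` as the known polynomial range. The circuits here are polynomial for
`m - k = O(log m)`. We could not find this bound in print (literature search partly degraded at the time;
see the crux work file `Cruxes/CliqueExtLowerBound/Disproof.lean`). Refuter seat
cdisprove-stmt-PneNP-10682-g2, 2026-08-16.
-/

namespace Summit.PneNP.PneNP.Theorems.CliqueExtLowerBound.Negative

open Literature.Computability.Complexity Literature.Computability.Complexity.CliqueLPGate Finset

/-! ### 7. The same over the plain monotone basis `{∧₂, ∨₂}` (fan-in two, no constants) -/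

section Monotone

variable {B : Set GateFn}

/-- Basis requirements for the fan-in-two version: `∧₂`, `∨₂` and the two constants. [folklore] -/
structure MonoBasis (B : Set GateFn) : Prop where
  and_mem : GateFn.and 2 ∈ B
  or_mem : GateFn.or 2 ∈ B
  true_mem : GateFn.const true ∈ B
  false_mem : GateFn.const false ∈ B

/-- `{∧₂, ∨₂, 0, 1}` qualifies. [folklore] -/
theorem MonoBasis.monotoneBasis01 : MonoBasis monotoneBasis01 :=
  ⟨monotoneBasis_subset_monotoneBasis01 (Set.mem_insert _ _),
   monotoneBasis_subset_monotoneBasis01 (Set.mem_insert_of_mem _ (Set.mem_singleton _)),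
   Set.mem_insert _ _, Set.mem_insert_of_mem _ (Set.mem_insert _ _)⟩

section GenericMono

variable {ι : Type*} (hB : MonoBasis B)
include hB

/-- Constants cost one gate. [folklore] -/
theorem cktSize_const01 (b : Bool) : CktSize B (fun (_ : ι → Bool) (_ : Unit) => b) 1 := by
  cases b
  · exact (CktSize.gate (B := B) (ι := ι) (GateFn.const false) hB.false_mem Fin.elim0).congr fun _ _ => rfl
  · exact (CktSize.gate (B := B) (ι := ι) (GateFn.const true) hB.true_mem Fin.elim0).congr fun _ _ => rfl

/-- `y i ∨ y j` costs one gate. [folklore] -/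
theorem cktSize_or2' (i j : ι) : CktSize B (fun (y : ι → Bool) (_ : Unit) => (y i || y j)) 1 :=
  (CktSize.gate (B := B) (GateFn.or 2) hB.or_mem ![i, j]).congr fun y u => by
    simp only [GateFn.or, Fin.exists_fin_two, Matrix.cons_val_zero, Matrix.cons_val_one]
    cases hi : y i <;> cases hj : y j <;> simp

/-- `y i ∧ y j` costs one gate. [folklore] -/
theorem cktSize_and2' (i j : ι) : CktSize B (fun (y : ι → Bool) (_ : Unit) => (y i && y j)) 1 :=
  (CktSize.gate (B := B) (GateFn.and 2) hB.and_mem ![i, j]).congr fun y u => by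
    simp only [GateFn.and, Fin.forall_fin_two, Matrix.cons_val_zero, Matrix.cons_val_one]
    cases hi : y i <;> cases hj : y j <;> simp

omit hB in
/-- AND of `n` wires as a chain of `∧₂` gates (plus one constant): `n + 1` gates. [folklore] -/
theorem cktSize_andChain_fin (hB : MonoBasis B) :
    ∀ n, CktSize B (fun (y : Fin n → Bool) (_ : Unit) => decide (∀ i, y i = true)) (n + 1)
  | 0 => (cktSize_const01 hB (ι := Fin 0) true).congr fun y u => by simp
  | n + 1 => by
    have ih := (cktSize_andChain_fin hB n).rewire (ι' := Fin (n + 1)) Fin.castSucc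
    have h2 := (ih.pair (CktSize.proj B fun _ : Unit => Fin.last n)).comp
      (cktSize_and2' hB (ι := Unit ⊕ Unit) (Sum.inl ()) (Sum.inr ()))
    refine (h2.of_le (by omega)).congr fun y u => ?_
    simp only [Sum.elim_inl, Sum.elim_inr, Fin.forall_fin_succ']
    by_cases h : ∀ i : Fin n, y i.castSucc = true
    · simp [h]
    · simp [h]

omit hB in
/-- OR of `n` wires as a chain of `∨₂` gates (plus one constant): `n + 1` gates. [folklore] -/
theorem cktSize_orChain_fin (hB : MonoBasis B) :
    ∀ n, CktSize B (fun (y : Fin n → Bool) (_ : Unit) => decide (∃ i, y i = true)) (n + 1)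
  | 0 => (cktSize_const01 hB (ι := Fin 0) false).congr fun y u => by simp
  | n + 1 => by
    have ih := (cktSize_orChain_fin hB n).rewire (ι' := Fin (n + 1)) Fin.castSucc
    have h2 := (ih.pair (CktSize.proj B fun _ : Unit => Fin.last n)).comp
      (cktSize_or2' hB (ι := Unit ⊕ Unit) (Sum.inl ()) (Sum.inr ()))
    refine (h2.of_le (by omega)).congr fun y u => ?_
    simp only [Sum.elim_inl, Sum.elim_inr, Fin.exists_fin_succ']
    by_cases h : ∃ i : Fin n, y i.castSucc = true
    · simp [h]
    · simp [h]

/-- AND of all coordinates: `card + 1` gates of fan-in two. [folklore] -/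
theorem cktSize_andAll01 [Fintype ι] :
    CktSize B (fun (y : ι → Bool) (_ : Unit) => decide (∀ i, y i = true)) (Fintype.card ι + 1) := by
  classical
  let e := Fintype.equivFin ι
  exact ((cktSize_andChain_fin hB (Fintype.card ι)).rewire (ι' := ι) e.symm).congr fun y u => by
    apply Bool.decide_congr
    exact ⟨fun h i => by simpa using h (e i), fun h a => h _⟩

/-- OR of all coordinates: `card + 1` gates of fan-in two. [folklore] -/
theorem cktSize_orAll01 [Fintype ι] :
    CktSize B (fun (y : ι → Bool) (_ : Unit) => decide (∃ i, y i = true)) (Fintype.card ι + 1) := by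
  classical
  let e := Fintype.equivFin ι
  exact ((cktSize_orChain_fin hB (Fintype.card ι)).rewire (ι' := ι) e.symm).congr fun y u => by
    apply Bool.decide_congr
    exact ⟨fun ⟨a, ha⟩ => ⟨_, ha⟩, fun ⟨i, hi⟩ => ⟨e i, by simpa using hi⟩⟩

end GenericMono

variable {m k : ℕ} (h : Fin m → Fin k) (hB : MonoBasis B)
include hB

/-- One term, at most one gate. [folklore] -/
theorem cktSize_term01 (a b c : Lt m) :
    CktSize B (fun (y : St m → Bool) (_ : Unit) =>
      (y (Sum.inr (a, c)) || noArcB h c b (fun e => y (Sum.inl e)))) 1 := by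
  rcases noArcB_cases h c b with hc | hc | ⟨e, hc⟩
  · exact (cktSize_const01 hB true).congr fun y u => by simp [hc]
  · exact ((CktSize.proj B fun _ : Unit => (Sum.inr (a, c) : St m)).of_le (Nat.zero_le 1)).congr
      fun y u => by simp [hc]
  · exact (cktSize_or2' hB (Sum.inr (a, c)) (Sum.inl e)).congr fun y u => by simp [hc]

/-- One output of a round: `card + (card + 1)` gates. [folklore] -/
theorem cktSize_roundEntry01 (ab : Lt m × Lt m) :
    CktSize B (fun (y : St m → Bool) (_ : Unit) => roundF h y (Sum.inr ab))
      (Fintype.card (Option (Lt m)) * 1 + (Fintype.card (Option (Lt m)) + 1)) := by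
  classical
  have hvec : CktSize B (fun (y : St m → Bool) (o : Option (Lt m)) => o.elim (y (Sum.inr ab))
      fun c => (y (Sum.inr (ab.1, c)) || noArcB h c ab.2 (fun e => y (Sum.inl e))))
      (Fintype.card (Option (Lt m)) * 1) := by
    refine CktSize.pi_const fun o => ?_
    cases o with
    | none => exact (CktSize.proj B fun _ : Unit => (Sum.inr ab : St m)).of_le (Nat.zero_le 1)
    | some c => exact cktSize_term01 h hB ab.1 ab.2 c
  refine (hvec.comp (cktSize_andAll01 hB)).congr fun y u => ?_
  simp only [roundF, Sum.elim_inr, Option.forall, Option.elim_none, Option.elim_some]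
  cases y (Sum.inr ab) <;> simp

/-- A round. [folklore] -/
theorem cktSize_roundF01 :
    CktSize B (roundF (m := m) h)
      (Fintype.card (Lt m × Lt m) * (Fintype.card (Option (Lt m)) * 1 + (Fintype.card (Option (Lt m)) + 1))) := by
  classical
  have := CktSize.pi (B := B) (f := fun (y : St m → Bool) (s : St m) => roundF h y s)
    (s := Sum.elim (fun _ => 0) fun _ => Fintype.card (Option (Lt m)) * 1 + (Fintype.card (Option (Lt m)) + 1)) ?_
  · refine this.of_le (le_of_eq ?_)
    rw [Fintype.sum_sum_type]
    simp
  · rintro (e | ab)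
    · exact (CktSize.proj B fun _ : Unit => (Sum.inl e : St m)).congr fun y u => by simp [roundF]
    · exact cktSize_roundEntry01 h hB ab

omit h in
/-- The initial state. [folklore] -/
theorem cktSize_initF01 : CktSize B (initF (m := m)) (Fintype.card (Lt m × Lt m) * 1) := by
  classical
  have := CktSize.pi (B := B) (f := fun (x : Ed m → Bool) (s : St m) => initF x s)
    (s := Sum.elim (fun _ => 0) fun _ => 1) ?_
  · refine this.of_le (le_of_eq ?_)
    rw [Fintype.sum_sum_type]; simp
  · rintro (e | ab)
    · exact (CktSize.proj B fun _ : Unit => e).congr fun y u => by simp [initF]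
    · exact (cktSize_const01 hB (decide (ab.2 ≠ ab.1))).congr fun y u => by simp [initF]

omit h in
/-- The output stage. [folklore] -/
theorem cktSize_outF01 :
    CktSize B (fun (y : St m → Bool) (_ : Unit) =>
      decide (∀ u : Fin m, (y (Sum.inr ((u, true), (u, false))) || y (Sum.inr ((u, false), (u, true)))) = true))
      (Fintype.card (Fin m) * 1 + (Fintype.card (Fin m) + 1)) :=
  ((CktSize.pi_const (B := B) (f := fun (y : St m → Bool) (u : Fin m) =>
      (y (Sum.inr ((u, true), (u, false))) || y (Sum.inr ((u, false), (u, true)))))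
    (fun _ => cktSize_or2' hB _ _)).comp (cktSize_andAll01 hB)).congr fun _ _ =>
      decide_eq_decide.mpr Iff.rfl

omit h hB in
/-- Size of the fan-in-two per-colouring circuit. [folklore] -/
def cutCircuitSize01 (m : ℕ) : ℕ :=
  Fintype.card (Lt m × Lt m) * 1 +
    Fintype.card (Lt m) * (Fintype.card (Lt m × Lt m) *
      (Fintype.card (Option (Lt m)) * 1 + (Fintype.card (Option (Lt m)) + 1))) +
    (Fintype.card (Fin m) * 1 + (Fintype.card (Fin m) + 1))

open Classical in
/-- The per-colouring cut test over a fan-in-two basis. [folklore] -/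
theorem cktSize_cutTest01 :
    CktSize B (fun (x : Ed m → Bool) (_ : Unit) =>
      decide (∀ u : Fin m, Cut h x (u, true) (u, false) ∨ Cut h x (u, false) (u, true)))
      (cutCircuitSize01 m) := by
  classical
  have h1 := ((cktSize_initF01 (m := m) hB).comp ((cktSize_roundF01 h hB).iterate (Fintype.card (Lt m)))).comp
    (cktSize_outF01 (m := m) hB)
  refine h1.congr fun x u => ?_
  simp only [iterate_roundF_initF, Sum.elim_inr]
  apply Bool.decide_congr
  refine forall_congr' fun v => ?_
  rw [cut_iff_not_mem_reachSet, cut_iff_not_mem_reachSet]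
  simp only [Bool.or_eq_true, decide_eq_true_eq]

omit h in
open Classical in
/-- The whole fan-in-two circuit: `card 𝓗 · cutCircuitSize01 m + (card 𝓗 + 1)` gates. [folklore] -/
theorem cktSize_family01 (𝓗 : Finset (Fin m → Fin k)) :
    CktSize B (fun (x : Ed m → Bool) (_ : Unit) =>
      decide (∃ h ∈ 𝓗, ∀ u : Fin m, Cut h x (u, true) (u, false) ∨ Cut h x (u, false) (u, true)))
      (Fintype.card ↥𝓗 * cutCircuitSize01 m + (Fintype.card ↥𝓗 + 1)) := by
  classical
  have h1 := (CktSize.pi_const (B := B) (f := fun (x : Ed m → Bool) (i : ↥𝓗) =>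
      decide (∀ u : Fin m, Cut i.1 x (u, true) (u, false) ∨ Cut i.1 x (u, false) (u, true)))
    (fun i => cktSize_cutTest01 (h := i.1) (hB := hB))).comp (cktSize_orAll01 hB)
  refine h1.congr fun x u => ?_
  apply Bool.decide_congr
  constructor
  · rintro ⟨i, hi⟩
    exact ⟨i.1, i.2, by simpa using hi⟩
  · rintro ⟨h, hh, hc⟩
    exact ⟨⟨h, hh⟩, by simpa using hc⟩

omit h hB in
/-- `cutCircuitSize01 m ≤ 63 m⁴` for `m ≥ 1`. [folklore] -/
theorem cutCircuitSize01_le {m : ℕ} (hm : 1 ≤ m) : cutCircuitSize01 m ≤ 63 * m ^ 4 := by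
  simp only [cutCircuitSize01, Fintype.card_prod, Fintype.card_bool, Fintype.card_option, Fintype.card_fin,
    mul_one]
  have h2 : m ≤ m ^ 2 := by nlinarith
  have h3 : m ^ 2 ≤ m ^ 3 := by nlinarith
  have h4 : m ^ 3 ≤ m ^ 4 := by nlinarith
  nlinarith

omit h hB in
/-- CLIQUE(m, s) is not constant for `2 ≤ s ≤ m`: it rejects the empty and accepts the complete graph.
[folklore] -/
theorem cliqueFn_nonconst {m s : ℕ} (h2 : 2 ≤ s) (hsm : s ≤ m) :
    cliqueFn m s (fun _ => false) = false ∧ cliqueFn m s (fun _ => true) = true := by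
  classical
  constructor
  · rw [Bool.eq_false_iff]
    intro h
    obtain ⟨S, hS, hall⟩ := (CliqueLPGate.cliqueFn_eq_true_iff_exists s _).1 h
    obtain ⟨a, ha, b, hb, hab⟩ := Finset.one_lt_card.1 (show 1 < S.card by rw [hS]; omega)
    have := hall (edgeOf hab) (fun y hy => by
      rcases Sym2.mem_iff.1 hy with rfl | rfl
      · exact ha
      · exact hb)
    exact Bool.false_ne_true this
  · obtain ⟨S, hS⟩ := (Finset.powersetCard_nonempty (s := (Finset.univ : Finset (Fin m))) (n := s)).2
      (by rw [Finset.card_univ, Fintype.card_fin]; exact hsm)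
    exact (CliqueLPGate.cliqueFn_eq_true_iff_exists s _).2
      ⟨S, (Finset.mem_powersetCard.1 hS).2, fun _ _ => rfl⟩

omit h hB in
open Filter in
/-- **Polynomial-size MONOTONE `{∧₂, ∨₂}`-circuits for CLIQUE(m, m - c·⌊log₃ m⌋)** (`c ≥ 1`, eventually in
`m`; at most `m^(c+7)` gates): the fan-in-two version of `exists_circuit_largeClique`, via constant
elimination (`const_or_exists_monotone_circuit`). This is the statement that sharpens Andreev–Jukna 2008
(Jukna 2012, Thm 9.7: polynomial for `m - k = O(√log m)`) to `m - k = O(log m)`. [folklore] -/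
theorem exists_monotone_circuit_largeClique (c : ℕ) (hc : 1 ≤ c) :
    ∀ᶠ m : ℕ in atTop, ∃ C : Circuit (Ed m), C.IsOver monotoneBasis ∧
      C.size ≤ m ^ (c + 7) ∧ C.Computes (cliqueFn m (m - c * Nat.log 3 m)) := by
  filter_upwards [eventually_ge_atTop (3 ^ c), eventually_ge_atTop 65,
    eventually_ge_atTop (3 ^ (c + 2))] with m hm hm65 hm'
  classical
  obtain ⟨hk1, hkm⟩ := clog_bounds hc hm
  set k := c * Nat.log 3 m with hkdef
  -- k ≤ m - 2 (so the target function is not constant): c·log₃ m + 2 ≤ (c+2)·log₃ m ≤ m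
  have hkm2 : 2 ≤ m - k := by
    obtain ⟨-, h'⟩ := clog_bounds (c := c + 2) (by omega) hm'
    have : 1 ≤ Nat.log 3 m := Nat.le_log_of_pow_le (by norm_num) (le_trans (by
      calc 3 ^ 1 ≤ 3 ^ c := Nat.pow_le_pow_right (by norm_num) hc
        _ = 3 ^ c := rfl) hm)
    have : c * Nat.log 3 m + 2 ≤ (c + 2) * Nat.log 3 m := by nlinarith
    omega
  obtain ⟨𝓗, hcard, hperf⟩ := exists_perfect_hash_family hk1 hkm (L := m ^ (c + 2))
    (hash_condition hc hm (by omega))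
  obtain ⟨C, hC, hs, he⟩ := (cktSize_family01 (B := monotoneBasis01) MonoBasis.monotoneBasis01 𝓗).toCircuit
  -- constant elimination
  have hfun : ∀ x, C.eval x = cliqueFn m (m - k) x := by
    intro x
    rw [he x, Bool.eq_iff_iff, decide_eq_true_iff,
      cliqueFn_sub_eq_true_iff_exists_coloring_cut hkm (𝓗 := (↑𝓗 : Set (Fin m → Fin k)))
        (fun S hS => by
          obtain ⟨h, hh, hinj⟩ := hperf S hS
          exact ⟨h, Finset.mem_coe.2 hh, hinj⟩) x]
    simp only [Finset.mem_coe]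
  have hsize : C.size ≤ m ^ (c + 7) := by
    refine hs.trans ?_
    have h1 : Fintype.card ↥𝓗 ≤ m ^ (c + 2) := by rw [Fintype.card_coe]; exact hcard
    have h2 := cutCircuitSize01_le (m := m) (by omega)
    have h3 : m ^ (c + 2) * (63 * m ^ 4) + (m ^ (c + 2) + 1) ≤ m ^ (c + 7) := by
      have : 65 * m ^ (c + 6) ≤ m ^ (c + 7) := by
        calc 65 * m ^ (c + 6) ≤ m * m ^ (c + 6) := Nat.mul_le_mul_right _ hm65
          _ = m ^ (c + 7) := by ring
      have : m ^ (c + 2) ≤ m ^ (c + 6) := Nat.pow_le_pow_right (by omega) (by omega)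
      have : 1 ≤ m ^ (c + 6) := Nat.one_le_pow _ _ (by omega)
      have : m ^ (c + 2) * (63 * m ^ 4) = 63 * m ^ (c + 6) := by ring
      omega
    calc Fintype.card ↥𝓗 * cutCircuitSize01 m + (Fintype.card ↥𝓗 + 1)
        ≤ m ^ (c + 2) * (63 * m ^ 4) + (m ^ (c + 2) + 1) := by gcongr
      _ ≤ m ^ (c + 7) := h3
  rcases GateList.const_or_exists_monotone_circuit C.gates C.output (GateList.wf_gates C) hC
      C.wf_output with ⟨b, hb⟩ | ⟨C', hC', hs', he'⟩
  · -- constant output is impossible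
    exfalso
    obtain ⟨hf, ht⟩ := cliqueFn_nonconst (m := m) (s := m - k) hkm2 (Nat.sub_le m k)
    have h0 := hb (fun _ => false)
    have h1 := hb (fun _ => true)
    rw [← GateList.circuit_eval, hfun] at h0 h1
    rw [hf] at h0; rw [ht] at h1
    exact Bool.false_ne_true (h0.trans h1.symm)
  · exact ⟨C', hC', hs'.trans hsize, fun x => by rw [he' x, ← GateList.circuit_eval, hfun]⟩

omit h hB in
open Filter in
/-- In the tree's notation: the monotone circuit complexity of CLIQUE(m, m - c·⌊log₃ m⌋) is at most
`m^(c+7)`, eventually in `m` (`c ≥ 1`). [folklore] -/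
theorem circuitSizeOver_largeClique_le (c : ℕ) (hc : 1 ≤ c) :
    ∀ᶠ m : ℕ in atTop, circuitSizeOver monotoneBasis (cliqueFn m (m - c * Nat.log 3 m)) ≤ m ^ (c + 7) :=
  (exists_monotone_circuit_largeClique c hc).mono fun _ ⟨C, hC, hs, hcomp⟩ =>
    (circuitSizeOver_le_of_computes C hC hcomp).trans hs

end Monotone

end Summit.PneNP.PneNP.Theorems.CliqueExtLowerBound.Negative
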